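import Summits.Ventures.Crystal3D.Theorems.StickyWulffConstantCoaxialWallLawGrainLedger
import HarnessLib

/-!
# The grain lemma of the terrace/riser ledger, RIM-LOCAL form (no dependence on the cell height)

HONEST FRAMING. Part of the venture `Summits/Ventures/Crystal3D` (cell `crystal3d-full`), helper
`--supports` the crux `CoaxialWallLaw` (stmt-Ventures-19481, `route-Ventures-StickyWulffConstant`),
REGISTERED line `WallLedgerF` (planner cf-p1 gen 16), stub `stub_coaxialTwoSlabAdhesion`
(terrace/riser slot ledger, RIGID rung).  Rung credit only.  Answers the planner's SHAPE-3
question (ROUTE.md §73.10: is the wall-law error rim-local / `h`-free?) for the F-line ledger: YES.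

Refinement of `coaxial_grain_ledger_ge` (`…CoaxialWallLawGrainLedger`).  Two observations:

* the climbing riser count needs neither the other grain nor the cell height: every bond line of a
  climbing in-plane class through the clamped sample `P` carries a run of grain balls whose TOP is
  a climbing vacancy (`innerCredits_ge` of line `WallLedgerG`: one structured top per line,
  `√2 ⟪A w, e₃⟫ πρ² − 10√2 πρ` of them, error `O(ρ)` from the disc's rim only) — so the riser
  count `√6 sin θ · πρ² − 30√2 πρ` is `h`-FREE (`upInPlane_credits_ge`);
* the only other loss of the per-ball ledger is at RIM balls (lateral radius `> ρ − 2`), `15` per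
  rim ball of the grain.

**Theorem (`coaxial_grain_ledger_rimLocal`, bottom grain).**  `X` `1`-separated in the cylinder
`{−2R₀ ≤ x₂ ≤ h + 2R₀, disc ρ}` (`3 ≤ R₀ ≤ ρ`), grain `Λ = A·Λ₀ + t` with complete clamped slab
`P = Λ ∩ {[−2R₀, −R₀] × disc ρ} ⊆ X`, absorption inequality at every ball of `X ∩ Λ`.  Then

  `Σ_{x ∈ X ∩ Λ} (12 − deg_X x) + 15 · #{rim balls of X ∩ Λ} ≥ (2φ + (√6/4)·√(1 − ⟪A e₃, e₃⟫²)) πρ² − (255/2)√2 π ρ`.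

No `h`, no second grain, no disjointness: the wall content is entirely in the absorption
hypothesis and in the disjointness of the credit families.  The top grain (mirror) and the
rim-local cell ledger / stub-shaped corollary are the next files.

WHAT THIS IS NOT: the stub; rung F-C1 not moved.
-/

noncomputable section

namespace Summit.Ventures.Crystal3D.Theorems

open Summit.Ventures.Crystal3D Finset
open Literature.MathematicalPhysics.StatisticalMechanics (fccStacking barlowPos constHagg barlowPos_mem
  triangularVec₁ triangularVec₂)
open scoped InnerProductSpace

/-- The three in-plane generators `u`, `v`, `v − u` are slots. -/
theorem inPlane_mem_fccSlots :
    triangularVec₁ (1 : ℝ) ∈ fccSlots ∧ triangularVec₂ (1 : ℝ) ∈ fccSlots ∧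
      triangularVec₂ (1 : ℝ) - triangularVec₁ 1 ∈ fccSlots := by
  obtain ⟨hu_eq, hv_eq⟩ := inPlane_generators_eq
  obtain ⟨nu, nv, nuv⟩ := norm_triangularVec_one
  have hu : triangularVec₁ (1 : ℝ) ∈ fccStacking 1 (Real.sqrt (2 / 3)) := by
    rw [← hu_eq]; exact barlowPos_mem _ _ _
  have hv : triangularVec₂ (1 : ℝ) ∈ fccStacking 1 (Real.sqrt (2 / 3)) := by
    rw [← hv_eq]; exact barlowPos_mem _ _ _
  exact ⟨mem_fccSlots_of_unit hu nu, mem_fccSlots_of_unit hv nv,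
    mem_fccSlots_of_unit (fcc_sub_site_mem hv hu) nuv⟩

open scoped Classical in
/-- **Climbing vacancies of one in-plane pair `±A w`, `h`-free count.**  For the clamped sample
`P ⊆ X ∩ Λ` and a slot `w`: `√2 |⟪A w, e₃⟫| πρ² − 10√2 πρ ≤ #{x : x + A w ∉ X, climbing} + #{x : x − A w ∉ X, climbing}`
over the grain balls `x ∈ X ∩ Λ` (structured run tops of the climbing member, `innerCredits_ge`). -/
theorem upPair_credits_ge
    (A : EuclideanSpace ℝ (Fin 3) ≃ₗᵢ[ℝ] EuclideanSpace ℝ (Fin 3)) (t : EuclideanSpace ℝ (Fin 3))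
    (X P : Finset (EuclideanSpace ℝ (Fin 3))) (R₀ ρ : ℝ) (hR₀ : 3 ≤ R₀) (hρ : R₀ ≤ ρ) (hPX : P ⊆ X)
    (hP : ∀ p, p ∈ P ↔ (p ∈ (fun q => A q + t) '' fccStacking 1 (Real.sqrt (2 / 3)) ∧
      -(2 * R₀) ≤ p 2 ∧ p 2 ≤ -R₀ ∧ p 0 ^ 2 + p 1 ^ 2 ≤ ρ ^ 2))
    {w : EuclideanSpace ℝ (Fin 3)} (hw : w ∈ fccSlots) :
    Real.sqrt 2 * |⟪A w, EuclideanSpace.single (2 : Fin 3) (1 : ℝ)⟫_ℝ| * Real.pi * ρ ^ 2 -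
        10 * Real.sqrt 2 * Real.pi * ρ ≤
      (((X.filter fun x => x ∈ (fun q => A q + t) '' fccStacking 1 (Real.sqrt (2 / 3))).filter
          fun x => x + A w ∉ X ∧ x 2 < (x + A w) 2).card : ℝ) +
      (((X.filter fun x => x ∈ (fun q => A q + t) '' fccStacking 1 (Real.sqrt (2 / 3))).filter
          fun x => x - A w ∉ X ∧ x 2 < (x - A w) 2).card : ℝ) := by
  classical
  set e₃ : EuclideanSpace ℝ (Fin 3) := EuclideanSpace.single (2 : Fin 3) (1 : ℝ) with he₃
  set Λ : Set (EuclideanSpace ℝ (Fin 3)) := (fun q => A q + t) '' fccStacking 1 (Real.sqrt (2 / 3)) with hΛ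
  set X₁ : Finset (EuclideanSpace ℝ (Fin 3)) := X.filter (fun x => x ∈ Λ) with hX₁
  have hPX₁ : P ⊆ X₁ := by
    intro p hp
    rw [hX₁, mem_filter]
    exact ⟨hPX hp, ((hP p).1 hp).1⟩
  have hρ0 : (0 : ℝ) ≤ ρ := by linarith
  have hc1 : (0 : ℝ) ≤ ((X₁.filter fun x => x + A w ∉ X ∧ x 2 < (x + A w) 2).card : ℝ) :=
    Nat.cast_nonneg _
  have hc2 : (0 : ℝ) ≤ ((X₁.filter fun x => x - A w ∉ X ∧ x 2 < (x - A w) 2).card : ℝ) :=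
    Nat.cast_nonneg _
  -- structured tops of a climbing slot `u` are climbing `u`-vacancies
  have key : ∀ u ∈ fccSlots, 0 < ⟪A u, e₃⟫_ℝ →
      Real.sqrt 2 * ⟪A u, e₃⟫_ℝ * Real.pi * ρ ^ 2 - 10 * Real.sqrt 2 * Real.pi * ρ ≤
        ((X₁.filter fun x => x + A u ∉ X ∧ x 2 < (x + A u) 2).card : ℝ) := by
    intro u hu hα
    have h1 := innerCredits_ge A t X₁ P R₀ ρ hR₀ hρ hPX₁ hP hu
    have h2 : (X₁.filter fun q => q + A u ∉ X₁ ∧ (q ∈ P ∨ q - A u ∈ X₁)).card ≤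
        (X₁.filter fun x => x + A u ∉ X ∧ x 2 < (x + A u) 2).card := by
      refine card_le_card fun q hq => ?_
      rw [mem_filter] at hq ⊢
      obtain ⟨hqX₁, hnot, -⟩ := hq
      have hqΛ : q ∈ Λ := (mem_filter.1 hqX₁).2
      refine ⟨hqX₁, fun hmem => hnot ?_, ?_⟩
      · rw [hX₁, mem_filter]
        exact ⟨hmem, movedFcc_add_site_mem A t hqΛ (mem_fcc_of_mem_fccSlots hu)⟩
      · rw [apply_two_add_eq_inner]; linarith
    have h2' : ((X₁.filter fun q => q + A u ∉ X₁ ∧ (q ∈ P ∨ q - A u ∈ X₁)).card : ℝ) ≤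
        ((X₁.filter fun x => x + A u ∉ X ∧ x 2 < (x + A u) 2).card : ℝ) := by exact_mod_cast h2
    exact h1.trans h2'
  rcases lt_trichotomy 0 ⟪A w, e₃⟫_ℝ with hpos | hzero | hneg
  · have := key w hw hpos
    rw [abs_of_pos hpos]
    linarith
  · rw [← hzero, abs_zero, mul_zero, zero_mul, zero_mul, zero_sub]
    have : 0 ≤ 10 * Real.sqrt 2 * Real.pi * ρ := by positivity
    linarith
  · have hw' : -w ∈ fccSlots := neg_mem_fccSlots hw
    have hpos' : 0 < ⟪A (-w), e₃⟫_ℝ := by rw [map_neg, inner_neg_left]; linarith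
    have := key (-w) hw' hpos'
    have hin : ⟪A (-w), e₃⟫_ℝ = -⟪A w, e₃⟫_ℝ := by rw [map_neg, inner_neg_left]
    rw [hin] at this
    have e : (X₁.filter fun x => x + A (-w) ∉ X ∧ x 2 < (x + A (-w)) 2) =
        (X₁.filter fun x => x - A w ∉ X ∧ x 2 < (x - A w) 2) := by
      simp only [map_neg, ← sub_eq_add_neg]
    rw [e] at this
    rw [abs_of_neg hneg]
    linarith

open scoped Classical in
/-- **The climbing riser count, `h`-free.**  For the clamped sample `P ⊆ X ∩ Λ` (`3 ≤ R₀ ≤ ρ`):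
`√6 · √(1 − ⟪A e₃, e₃⟫²) · πρ² − 30√2 πρ ≤ Σ_{x ∈ X ∩ Λ} #{w ∈ fccSlots : w₂ = 0, x + A w ∉ X, x₂ < (x + A w)₂}`. -/
theorem upInPlane_credits_ge
    (A : EuclideanSpace ℝ (Fin 3) ≃ₗᵢ[ℝ] EuclideanSpace ℝ (Fin 3)) (t : EuclideanSpace ℝ (Fin 3))
    (X P : Finset (EuclideanSpace ℝ (Fin 3))) (R₀ ρ : ℝ) (hR₀ : 3 ≤ R₀) (hρ : R₀ ≤ ρ) (hPX : P ⊆ X)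
    (hP : ∀ p, p ∈ P ↔ (p ∈ (fun q => A q + t) '' fccStacking 1 (Real.sqrt (2 / 3)) ∧
      -(2 * R₀) ≤ p 2 ∧ p 2 ≤ -R₀ ∧ p 0 ^ 2 + p 1 ^ 2 ≤ ρ ^ 2)) :
    Real.sqrt 6 * Real.sqrt (1 - ⟪A (EuclideanSpace.single (2 : Fin 3) (1 : ℝ)),
        EuclideanSpace.single (2 : Fin 3) (1 : ℝ)⟫_ℝ ^ 2) * Real.pi * ρ ^ 2 -
        30 * Real.sqrt 2 * Real.pi * ρ ≤
      ∑ x ∈ X.filter (fun p => p ∈ (fun q => A q + t) '' fccStacking 1 (Real.sqrt (2 / 3))),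
        (((fccSlots.filter fun w => w 2 = 0 ∧ (x + A w ∉ X ∧ x 2 < (x + A w) 2)).card : ℕ) : ℝ) := by
  classical
  obtain ⟨hus, hvs, huvs⟩ := inPlane_mem_fccSlots
  have cu := upPair_credits_ge A t X P R₀ ρ hR₀ hρ hPX hP hus
  have cv := upPair_credits_ge A t X P R₀ ρ hR₀ hρ hPX hP hvs
  have cuv := upPair_credits_ge A t X P R₀ ρ hR₀ hρ hPX hP huvs
  set X₁ := X.filter fun p => p ∈ (fun q => A q + t) '' fccStacking 1 (Real.sqrt (2 / 3)) with hX₁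
  have hsum : ∑ x ∈ X₁, (((fccSlots.filter fun w => w 2 = 0 ∧ (x + A w ∉ X ∧ x 2 < (x + A w) 2)).card : ℕ) : ℝ) =
      ((X₁.filter fun p => p + A (triangularVec₁ 1) ∉ X ∧ p 2 < (p + A (triangularVec₁ 1)) 2).card : ℝ) +
      ((X₁.filter fun p => p - A (triangularVec₁ 1) ∉ X ∧ p 2 < (p - A (triangularVec₁ 1)) 2).card : ℝ) +
      ((X₁.filter fun p => p + A (triangularVec₂ 1) ∉ X ∧ p 2 < (p + A (triangularVec₂ 1)) 2).card : ℝ) +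
      ((X₁.filter fun p => p - A (triangularVec₂ 1) ∉ X ∧ p 2 < (p - A (triangularVec₂ 1)) 2).card : ℝ) +
      ((X₁.filter fun p => p + A (triangularVec₂ 1 - triangularVec₁ 1) ∉ X ∧
          p 2 < (p + A (triangularVec₂ 1 - triangularVec₁ 1)) 2).card : ℝ) +
      ((X₁.filter fun p => p - A (triangularVec₂ 1 - triangularVec₁ 1) ∉ X ∧
          p 2 < (p - A (triangularVec₂ 1 - triangularVec₁ 1)) 2).card : ℝ) := by
    have h1 : ∑ x ∈ X₁, ((fccSlots.filter fun w => w 2 = 0 ∧ (x + A w ∉ X ∧ x 2 < (x + A w) 2)).card : ℕ) =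
        (X₁.filter fun p => p + A (triangularVec₁ 1) ∉ X ∧ p 2 < (p + A (triangularVec₁ 1)) 2).card +
        (X₁.filter fun p => p - A (triangularVec₁ 1) ∉ X ∧ p 2 < (p - A (triangularVec₁ 1)) 2).card +
        (X₁.filter fun p => p + A (triangularVec₂ 1) ∉ X ∧ p 2 < (p + A (triangularVec₂ 1)) 2).card +
        (X₁.filter fun p => p - A (triangularVec₂ 1) ∉ X ∧ p 2 < (p - A (triangularVec₂ 1)) 2).card +
        (X₁.filter fun p => p + A (triangularVec₂ 1 - triangularVec₁ 1) ∉ X ∧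
            p 2 < (p + A (triangularVec₂ 1 - triangularVec₁ 1)) 2).card +
        (X₁.filter fun p => p - A (triangularVec₂ 1 - triangularVec₁ 1) ∉ X ∧
            p 2 < (p - A (triangularVec₂ 1 - triangularVec₁ 1)) 2).card := by
      rw [Finset.sum_congr rfl (fun x _ => card_upInPlane_eq_six A X x)]
      simp only [sum_add_distrib, ← card_filter]
    exact_mod_cast congrArg (Nat.cast : ℕ → ℝ) h1
  rw [hsum]
  have htilt := coaxial_sine_le_inPlaneClasses A
  have hπρ : 0 ≤ Real.pi * ρ ^ 2 := by positivity
  have hmul := mul_le_mul_of_nonneg_right htilt hπρ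
  nlinarith [cu, cv, cuv, hmul]

open scoped Classical in
/-- **The grain lemma of the terrace/riser ledger, rim-local form (bottom grain).**  See the module
docstring. -/
theorem coaxial_grain_ledger_rimLocal
    (A : EuclideanSpace ℝ (Fin 3) ≃ₗᵢ[ℝ] EuclideanSpace ℝ (Fin 3)) (t : EuclideanSpace ℝ (Fin 3))
    (X P : Finset (EuclideanSpace ℝ (Fin 3))) (R₀ h ρ : ℝ) (hR₀ : 3 ≤ R₀) (hρ : R₀ ≤ ρ)
    (hX : ∀ p ∈ X, ∀ q ∈ X, p ≠ q → 1 ≤ dist p q)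
    (hcell : ∀ p ∈ X, -(2 * R₀) ≤ p 2 ∧ p 2 ≤ h + 2 * R₀ ∧ p 0 ^ 2 + p 1 ^ 2 ≤ ρ ^ 2)
    (hPX : P ⊆ X)
    (hP : ∀ p, p ∈ P ↔ (p ∈ (fun q => A q + t) '' fccStacking 1 (Real.sqrt (2 / 3)) ∧
      -(2 * R₀) ≤ p 2 ∧ p 2 ≤ -R₀ ∧ p 0 ^ 2 + p 1 ^ 2 ≤ ρ ^ 2))
    (habs : ∀ x ∈ X, x ∈ (fun q => A q + t) '' fccStacking 1 (Real.sqrt (2 / 3)) →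
      (fccSlots.filter fun w => w 2 = 0 ∧ x + A w ∉ X).card +
        4 * (X.filter fun q => dist x q = 1).card ≤ 48) :
    (2 * (Real.sqrt 2 / 4 * ∑ w ∈ fccSlots, |⟪A w, EuclideanSpace.single (2 : Fin 3) (1 : ℝ)⟫_ℝ|) +
        Real.sqrt 6 / 4 * Real.sqrt (1 - ⟪A (EuclideanSpace.single (2 : Fin 3) (1 : ℝ)),
          EuclideanSpace.single (2 : Fin 3) (1 : ℝ)⟫_ℝ ^ 2)) * Real.pi * ρ ^ 2 -
        255 / 2 * Real.sqrt 2 * Real.pi * ρ ≤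
      ∑ x ∈ X.filter (fun x => x ∈ (fun q => A q + t) '' fccStacking 1 (Real.sqrt (2 / 3))),
        ((12 : ℝ) - ((X.filter fun q => dist x q = 1).card : ℝ)) +
      15 * (((X.filter (fun x => x ∈ (fun q => A q + t) '' fccStacking 1 (Real.sqrt (2 / 3)))).filter
        fun x => (ρ - 2) ^ 2 < x 0 ^ 2 + x 1 ^ 2).card : ℝ) := by
  classical
  set e₃ : EuclideanSpace ℝ (Fin 3) := EuclideanSpace.single (2 : Fin 3) (1 : ℝ) with he₃
  set Λ : Set (EuclideanSpace ℝ (Fin 3)) := (fun q => A q + t) '' fccStacking 1 (Real.sqrt (2 / 3)) with hΛ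
  set X₁ : Finset (EuclideanSpace ℝ (Fin 3)) := X.filter (fun x => x ∈ Λ) with hX₁
  set Down : Finset (EuclideanSpace ℝ (Fin 3)) := fccSlots.filter (fun w => ⟪A w, e₃⟫_ℝ < 0) with hDown
  set O : EuclideanSpace ℝ (Fin 3) → Finset (EuclideanSpace ℝ (Fin 3)) :=
    fun w => P.filter (fun p => p + A w ∉ P) with hO
  set U : EuclideanSpace ℝ (Fin 3) → ℕ :=
    fun x => (fccSlots.filter fun w => w 2 = 0 ∧ (x + A w ∉ X ∧ x 2 < (x + A w) 2)).card with hU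
  set deg : EuclideanSpace ℝ (Fin 3) → ℕ := fun x => (X.filter fun q => dist x q = 1).card with hdeg
  set k : EuclideanSpace ℝ (Fin 3) → ℕ :=
    fun x => 4 * (Down.filter fun w => x ∈ O w).card + U x with hk
  have hρ0 : (0 : ℝ) ≤ ρ := by linarith
  have hPX₁ : P ⊆ X₁ := by
    intro p hp
    rw [hX₁, mem_filter]
    exact ⟨hPX hp, ((hP p).1 hp).1⟩
  have hX₁X : X₁ ⊆ X := filter_subset _ _
  -- (1) credit counts: outer face and climbing riser count (both `h`-free)
  have hOut := outerCredits_ge A t P R₀ ρ hR₀ hρ hP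
  have hIn := upInPlane_credits_ge A t X P R₀ ρ hR₀ hρ hPX hP
  -- (2) the sum of the credits per ball
  have hk_sum : ∑ x ∈ X₁, (k x : ℝ) = 4 * ∑ w ∈ Down, ((O w).card : ℝ) + ∑ x ∈ X₁, (U x : ℝ) := by
    have hN1 : ∑ x ∈ X₁, (Down.filter fun w => x ∈ O w).card = ∑ w ∈ Down, (O w).card := by
      rw [Finset.sum_congr rfl (fun x _ => Finset.card_filter (fun w => x ∈ O w) Down), Finset.sum_comm]
      refine sum_congr rfl fun w _ => ?_
      rw [← Finset.card_filter, filter_mem_eq_inter, inter_eq_right.2 ((filter_subset _ _).trans hPX₁)]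
    have hN : ∑ x ∈ X₁, k x = 4 * ∑ w ∈ Down, (O w).card + ∑ x ∈ X₁, U x := by
      simp only [hk, sum_add_distrib, ← mul_sum, hN1]
    have := congrArg (Nat.cast : ℕ → ℝ) hN
    push_cast at this
    exact this
  -- (3) per-ball facts
  have hdeg12 : ∀ x, deg x ≤ 12 := fun x => card_filter_dist_eq_one_le_twelve X hX x
  have hk60 : ∀ x, k x ≤ 60 := by
    intro x
    have h1 : (Down.filter fun w => x ∈ O w).card ≤ 12 :=
      (card_filter_le _ _).trans ((card_filter_le _ _).trans (by rw [card_fccSlots]))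
    have h2 : U x ≤ 12 := (card_filter_le _ _).trans (by rw [card_fccSlots])
    simp only [hk]; omega
  have hk_le : ∀ x ∈ X₁, ¬ ((ρ - 2) ^ 2 < x 0 ^ 2 + x 1 ^ 2) → (k x : ℝ) ≤ 4 * (12 - (deg x : ℝ)) := by
    intro x hx hrim
    push Not at hrim
    have hxX : x ∈ X := hX₁X hx
    have hxΛ : x ∈ Λ := (mem_filter.1 hx).2
    have key : k x ≤ 4 * (12 - deg x) := by
      simp only [hk, hdeg, hDown, hO, hU]
      exact coaxial_ball_ledger A t X P R₀ h ρ hR₀ hρ hX hcell hPX hP hxΛ hrim (habs x hxX hxΛ)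
    have h1 : ((k x : ℕ) : ℝ) ≤ ((4 * (12 - deg x) : ℕ) : ℝ) := by exact_mod_cast key
    have h2 : ((4 * (12 - deg x) : ℕ) : ℝ) = 4 * (12 - (deg x : ℝ)) := by
      have := hdeg12 x
      push_cast [Nat.cast_sub this]
      ring
    rw [h2] at h1
    exact h1
  -- (4) pointwise: `4 (12 − deg x) + 60·[rim x] ≥ k x` on `X₁`
  have hpt : ∀ x ∈ X₁, (k x : ℝ) - 60 * (if (ρ - 2) ^ 2 < x 0 ^ 2 + x 1 ^ 2 then 1 else 0) ≤
      4 * (12 - (deg x : ℝ)) := by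
    intro x hx
    split_ifs with hr
    · have h1 : (k x : ℝ) ≤ 60 := by exact_mod_cast hk60 x
      have h2 : (deg x : ℝ) ≤ 12 := by exact_mod_cast hdeg12 x
      linarith
    · have := hk_le x hx hr; simpa using this
  have hsum := Finset.sum_le_sum hpt
  rw [sum_sub_distrib, ← mul_sum, sum_boole, ← mul_sum] at hsum
  rw [hk_sum] at hsum
  -- assemble
  have hDeg : ∑ x ∈ X₁, ((12 : ℝ) - ((X.filter fun q => dist x q = 1).card : ℝ)) =
      ∑ x ∈ X₁, ((12 : ℝ) - (deg x : ℝ)) := rfl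
  rw [hDeg]
  have hIn' : Real.sqrt 6 * Real.sqrt (1 - ⟪A e₃, e₃⟫_ℝ ^ 2) * Real.pi * ρ ^ 2 -
      30 * Real.sqrt 2 * Real.pi * ρ ≤ ∑ x ∈ X₁, (U x : ℝ) := hIn
  linarith [hOut, hIn', hsum]

end Summit.Ventures.Crystal3D.Theorems

end
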